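import Summits.ResolutionOfSingularities.ResolutionOfSingularities.Theorems.EquisingularLiftEquisingularLiftNatNoseRoundStageOfModel
import HarnessLib

/-!
# [OURS · L1 W4.5(b) · EL♮(3) · WIDTH TABLE D15 «ν-LIFT DOOR», engine (E1) — SCRATCH] THE SECTIONS STEP OF THE ν-LIFT NOSE MOVE, UPSTAIRS:
# «|S| point steps with PRESCRIBED sections `𝓢`, then the chain stage at `Bl_𝓢` CARRYING the slot's centre `C` of `Z^st`» (stage-generic and at the
# initial stage), and the composite with PHASE 2 (✓ `Equinodal.noseRound_stage_of_model`) over the B‴ tail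

res-L1-w45b-nose-w1 g7 (WIDTH seat D-0157 DOOR 1), on the desk's RULING R77a (4) 2026-08-29T10:18:57Z «nose-w1 — SCRATCH the engine: ONE composite
initial stage twin «|S| point steps with PRESCRIBED sections, then the round with the slot's C» …, pattern ✓ `hsube_of_suppliers`»; shape of record =
res-type-027 g24 `D15-SHAPE-NOTE.md` fca587f9997d9a32 (T4) + res-L1-w45b-idea-2 g30 SIZING (i) with (σ2) «S ⊆ S_Z free»: slot
`NoseLift₀ k n H ι Z hZ S` = «∃ sections 𝓢 (regular, O-flat, `𝓢.comap j₀ = 𝓘⟨S⟩`) ∧ ∀ their blow-up X₁, ∀ model square j₁, ∃ C regular O-flat with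
`C.comap j₁ = 𝓘⟨Z^st⟩`».  OURS; NOT a statement of any manuscript ([Hironaka2017] is a candidate under adjudication, nothing of it is asserted); AI-written,
weaker than expert review.  DEF-FREE; no `sorry`; standard axioms; the slot datum enters as EXPLICIT HYPOTHESES (027's `DefsE8` is not typed yet — the
door-side adapter is a re-ordering at worst).  `--supports stmt-ResolutionOfSingularities-20148 --as helper`.  EL♮(3) is NOT proved here.

WHAT.
* `sectionsStep_stage_of_model` — STAGE-GENERIC: at ANY downstairs stage `(F₁, T₁)` with an upstairs chain stage `(X', σ', S', j, t)` CARRYING a regular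
  `O`-flat model `𝓢` of a closed `S ⊆ T₁`, `T₁ ⊄ S` (reduced trace `𝓢.comap j = 𝓘⟨S⟩` — the HEND-block shape of ✓ `hsube_of_suppliers` / ✓
  `noseRound_stage_of_model`, with `S` in place of the nose), the downstairs blow-up `υ : F₂ ⟶ F₁` of `𝓘⟨S⟩`, and the SLOT PROMISE «for the blow-up
  `τ : X₁ ⟶ X'` of `𝓢` and its model square `j₁` over `υ`, a regular `O`-flat `C` on `X₁` with `C.comap j₁ = 𝓘⟨Z₂⟩`» (any closed `Z₂ ⊆ F₂`), THE SAME
  HEND-block at the new stage `(F₂, T₂ := closure (υ ⁻¹' (T₁ ∖ S)), Z₂)` with the model `C` — i.e. exactly the `hmodel` input of ✓ `noseRound_stage_of_model`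
  (and of its Σ / ΣPG twins).  Proof: E1-legality of `𝓢` from the chain (✓ `image_support_subset_not_isGenericPoint_of_chain`), `exists_isBlowup`, ✓
  `modelStep_chain` (the `Ch`-step at the regular `O`-flat centre `𝓢`, the model square `j₁ ≫ τ = υ ≫ j`, irreducibility of `T₂`), then the slot.
  `S = ∅` is allowed (`𝓘⟨∅⟩ = ⊤`; the supplier then answers for `υ` an isomorphism).
* `sectionsStep_stage_zero_of_model` — the same AT THE INITIAL STAGE of the K5 engines (`ℙ³_O`, `𝟙`, `Y = range (ι ≫ Proj φ)`, base model square
  `ProjectiveAmbientFibre.isPullback_projMap` — via ✓ `hendBlock_stage_zero_of_model` with `𝓦 := 𝓢`), the slot promise quantified over the blow-ups of `𝓢`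
  on `ℙ³_O` exactly as idea-2's `NoseLift₀` text reads (`∀ X₁ τ, IsBlowup τ 𝓢 → ∀ j₁ t₁, IsPullback j₁ t₁ (τ ≫ q) (Spec.map θ) → j₁ ≫ τ = υ ≫ Proj φ → ∃ C, …`).
* `liftNose_stage_zero_of_model` — the COMPOSITE over the B‴ tail of record today: sections step, then ✓ `noseRound_stage_of_model` (PHASE 2) at
  `(F₂, T₂, Z₂)` ⇒ the new upstairs stage in HSUBʰ/HSUBⁱ currency, host dropped (`LetterDatum … ∅`).  The D15 door's tail is the ΣPG list; its composite is
  this one with `noseRound_stage_of_model ↦ noseRound_stage_of_model_sigmaPG` (res-L1-w45b-stub-2 (3′), to land) — one token.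
[cite: Liu2002, §8.1 and Thm. 8.1.19] [cite: StacksProject, Tag 02OS] [folklore; pure re-composition of ✓ modules]
-/

set_option linter.dupNamespace false -- mandated namespace `Summit.<Summit>.<Problem>` of this single-conjunct summit
set_option linter.overlappingInstances false -- signatures carry `[IsDomain O] [IsDiscreteValuationRing O]`

noncomputable section

open CategoryTheory CategoryTheory.Limits AlgebraicGeometry TopologicalSpace Topology IsLocalRing
open MvPolynomial
open Literature.AlgebraicGeometry.Resolution
open AlgebraicGeometry.Scheme.IdealSheafData
open Summit.ResolutionOfSingularities.ResolutionOfSingularities.Theses.EquisingularLift.Split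
open Summit.ResolutionOfSingularities.ResolutionOfSingularities.Cruxes.EquisingularLift.StrataSplit

namespace Summit.ResolutionOfSingularities.ResolutionOfSingularities.Cruxes.EquisingularLiftNat.Sections.LiftNose

/-- **THE SECTIONS STEP, STAGE-GENERIC**: from an upstairs chain stage carrying a regular `O`-flat model `𝓢` of the closed `S ⊆ T₁` (`T₁ ⊄ S`) with reduced
trace, the downstairs blow-up `υ` of `𝓘⟨S⟩` and the slot's promise of a centre on the blow-up of `𝓢`, the HEND block at the new stage
`(F₂, closure (υ ⁻¹' (T₁ ∖ S)), Z₂)` with that centre as its model (= the `hmodel` input of ✓ `Equinodal.noseRound_stage_of_model`).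
[OURS · L1 W4.5b · D15 engine (E1), scratch; counted 0; EL♮(3) NOT proved] -/
theorem sectionsStep_stage_of_model (k : Type) [Field k]
    (O : Type) [CommRing O] [IsDomain O] [IsDiscreteValuationRing O] (θ : O →+* k) (hθ : Function.Surjective θ)
    (P : Scheme.{0}) (q : P ⟶ Spec (.of O)) (Y : Set P) (Ch : ∀ X' : Scheme.{0}, (X' ⟶ P) → Set X' → Prop)
    (hChStep : ∀ (X' X'' : Scheme.{0}) (σ' : X' ⟶ P) (S' : Set X') (C : X'.IdealSheafData) (τ : X'' ⟶ X'),
      Ch X' σ' S' → IsBlowup τ C → Scheme.IsRegular C.subscheme → Flat (C.subschemeι ≫ σ' ≫ q) →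
      σ' '' (C.support : Set X') ⊆ {y | ¬ IsGenericPoint y Y} → (C.support : Set X') ∩ (σ' ≫ q) ⁻¹' {IsLocalRing.closedPoint O} ⊆ S' →
      Ch X'' (τ ≫ σ') (closure (τ ⁻¹' (S' \ (C.support : Set X')))))
    (hChSplit : ∀ (X' : Scheme.{0}) (σ' : X' ⟶ P) (S' : Set X'), Ch X' σ' S' → Chain P Y X' σ' S')
    (hYsp : Y ⊆ q ⁻¹' {IsLocalRing.closedPoint O}) (hYirr : IsIrreducible Y) (hYcl : IsClosed Y)
    -- the downstairs stage `(F₁, T₁)` and the closed set `S` of the door's point steps (`S ⊆ T₁`, `T₁ ⊄ S`; `S = ∅` allowed)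
    (F₁ : Scheme.{0}) (T₁ S : Set F₁) (hS : IsClosed S) (hST : S ⊆ T₁) (hTS : ¬ (T₁ ⊆ S))
    -- the downstairs blow-up of `𝓘⟨S⟩` and the closed set `Z₂` the next round will blow up
    (F₂ : Scheme.{0}) (υ : F₂ ⟶ F₁) (hυ : IsBlowup υ (vanishingIdeal (⟨S, hS⟩ : Closeds F₁))) (Z₂ : Set F₂) (hZ₂ : IsClosed Z₂)
    -- the upstairs stage of `(F₁, T₁)` WITH a regular `O`-flat model `𝓢` of `S` with reduced trace (the PRESCRIBED SECTIONS) and the slot's promise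
    (hmodel : ∃ (X' : Scheme.{0}) (σ' : X' ⟶ P) (S' : Set X') (j : F₁ ⟶ X') (t : F₁ ⟶ Spec (.of k)) (𝓢 : X'.IdealSheafData),
        Ch X' σ' S' ∧ IsIntegral X' ∧ IsLocallyNoetherian X' ∧ Scheme.IsRegular X' ∧ IsDominant (σ' ≫ q) ∧ IsIntegral F₁ ∧
        IsPullback j t (σ' ≫ q) (Spec.map (CommRingCat.ofHom θ)) ∧ IsClosed T₁ ∧ IsIrreducible T₁ ∧ j '' T₁ = S' ∧
        Scheme.IsRegular 𝓢.subscheme ∧ Flat (𝓢.subschemeι ≫ σ' ≫ q) ∧ 𝓢.comap j = vanishingIdeal (⟨S, hS⟩ : Closeds F₁) ∧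
        -- the SLOT's promise at this stage: on the blow-up of `𝓢`, over the model square of `υ`, a regular `O`-flat centre with reduced trace `Z₂`
        ∀ (X₁ : Scheme.{0}) (τ : X₁ ⟶ X'), IsBlowup τ 𝓢 →
          ∀ (j₁ : F₂ ⟶ X₁) (t₁ : F₂ ⟶ Spec (.of k)), IsPullback j₁ t₁ ((τ ≫ σ') ≫ q) (Spec.map (CommRingCat.ofHom θ)) → j₁ ≫ τ = υ ≫ j →
          ∃ C : X₁.IdealSheafData, Scheme.IsRegular C.subscheme ∧ Flat (C.subschemeι ≫ (τ ≫ σ') ≫ q) ∧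
            C.comap j₁ = vanishingIdeal (⟨Z₂, hZ₂⟩ : Closeds F₂)) :
    ∃ (X₁ : Scheme.{0}) (σ₁ : X₁ ⟶ P) (S₁ : Set X₁) (j₁ : F₂ ⟶ X₁) (t₁ : F₂ ⟶ Spec (.of k)) (C : X₁.IdealSheafData),
      Ch X₁ σ₁ S₁ ∧ IsIntegral X₁ ∧ IsLocallyNoetherian X₁ ∧ Scheme.IsRegular X₁ ∧ IsDominant (σ₁ ≫ q) ∧ IsIntegral F₂ ∧
      IsPullback j₁ t₁ (σ₁ ≫ q) (Spec.map (CommRingCat.ofHom θ)) ∧ IsClosed (closure (υ ⁻¹' (T₁ \ S))) ∧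
      IsIrreducible (closure (υ ⁻¹' (T₁ \ S))) ∧ j₁ '' (closure (υ ⁻¹' (T₁ \ S))) = S₁ ∧
      Scheme.IsRegular C.subscheme ∧ Flat (C.subschemeι ≫ σ₁ ≫ q) ∧ C.comap j₁ = vanishingIdeal (⟨Z₂, hZ₂⟩ : Closeds F₂) := by
  classical
  obtain ⟨X', σ', S', j, t, 𝓢, hCh', hX'int, hX'noeth, hX'reg, hX'dom, hF₁, hsq, hT₁cl, hT₁irr, hjT₁, h𝓢reg, h𝓢fl, h𝓢j, hslot⟩ := hmodel
  subst hjT₁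
  haveI := hX'int; haveI := hX'noeth; haveI := hF₁
  -- E1-legality of `𝓢` upstairs: off the generic point of `Y` (from the chain and `¬ T₁ ⊆ S`)
  have hoff : σ' '' (𝓢.support : Set X') ⊆ {y : P | ¬ IsGenericPoint y Y} :=
    image_support_subset_not_isGenericPoint_of_chain θ hθ q Y hYsp σ' (j '' T₁) (hChSplit _ _ _ hCh') j t hsq T₁ rfl 𝓢 S hS h𝓢j hTS
  -- the upstairs blow-up of `𝓢` and the model square for `υ` (`modelStep_chain`)
  have hDT : (((vanishingIdeal (⟨S, hS⟩ : Closeds F₁)) : F₁.IdealSheafData).support : Set F₁) ⊆ T₁ := by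
    rw [Scheme.IdealSheafData.coe_support_vanishingIdeal]; exact hST
  have hTD : ¬ T₁ ⊆ (((vanishingIdeal (⟨S, hS⟩ : Closeds F₁)) : F₁.IdealSheafData).support : Set F₁) := by
    rw [Scheme.IdealSheafData.coe_support_vanishingIdeal]; exact hTS
  obtain ⟨X₁, τ, hτ⟩ := exists_isBlowup X' 𝓢
  obtain ⟨hX₁i, hX₁n, hX₁r, hX₁dom, hF₂i, hirr₂, j₁, t₁, hsq₁, hcomm₁, hCh₁⟩ :=
    modelStep_chain O k θ hθ P q Y hYirr hYcl Ch hChSplit hChStep X' σ' (j '' T₁) hCh' hX'reg hX'dom F₁ j t hsq T₁ rfl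
      𝓢 (vanishingIdeal (⟨S, hS⟩ : Closeds F₁)) h𝓢j h𝓢reg h𝓢fl hoff hDT hTD X₁ τ hτ F₂ υ hυ
  rw [Scheme.IdealSheafData.coe_support_vanishingIdeal] at hirr₂ hCh₁
  -- the slot's centre on `X₁`
  obtain ⟨C, hCreg, hCfl, hCj⟩ := hslot X₁ τ hτ j₁ t₁ hsq₁ hcomm₁
  refine ⟨X₁, τ ≫ σ', _, j₁, t₁, C, hCh₁, hX₁i, hX₁n, hX₁r, ?_, hF₂i, ?_, isClosed_closure, hirr₂, rfl, hCreg, ?_, hCj⟩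
  · simpa only [Category.assoc] using hX₁dom
  · simpa only [Category.assoc] using hsq₁
  · simpa only [Category.assoc] using hCfl

/-- **THE SECTIONS STEP AT THE INITIAL STAGE** of the K5 engines (`ℙ³_O` over `O`, graded coefficient map `φ` over `θ`, `Ch` at `(ℙ³_O, 𝟙, Y)`,
`Y = range (ι ≫ Proj φ)`): PRESCRIBED SECTIONS `𝓢` on `ℙ³_O` (regular, `O`-flat, `𝓢.comap (Proj φ) = 𝓘⟨S⟩`, `S ⊆ range ι`, `range ι ⊄ S`), the downstairs
blow-up `υ : F₂ ⟶ ℙ³_k` of `𝓘⟨S⟩` and the slot's promise «on every blow-up `τ : X₁ ⟶ ℙ³_O` of `𝓢`, over every model square `j₁` of `υ`, a regular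
`O`-flat `C` with `C.comap j₁ = 𝓘⟨Z₂⟩`» give the HEND block at `(F₂, closure (υ ⁻¹' (range ι ∖ S)), Z₂)` with the model `C`.
= `sectionsStep_stage_of_model` at the concrete initial stage (✓ `hendBlock_stage_zero_of_model`'s base square and dominance bytes). [OURS · L1 W4.5b · D15 engine (E1), scratch; counted 0; EL♮(3) NOT proved] -/
theorem sectionsStep_stage_zero_of_model (k : Type) [Field k] [IsAlgClosed k] (H : Scheme.{0})
    (ι : H ⟶ (Literature.AlgebraicGeometry.Motives.projectiveSpace 3 k).left)
    (hι : AlgebraicGeometry.IsClosedImmersion ι) (hH : AlgebraicGeometry.IsIntegral H)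
    (O : Type) [CommRing O] [IsDomain O] [IsDiscreteValuationRing O] (θ : O →+* k) (hθ : Function.Surjective θ) :
    letI := MvPolynomial.gradedAlgebra (σ := Fin (3 + 1)) (R := O); letI := MvPolynomial.gradedAlgebra (σ := Fin (3 + 1)) (R := k);
    ∀ (φ : MvPolynomial.homogeneousSubmodule (Fin (3 + 1)) O →+*ᵍ MvPolynomial.homogeneousSubmodule (Fin (3 + 1)) k)
      (hφ' : HomogeneousIdeal.irrelevant (MvPolynomial.homogeneousSubmodule (Fin (3 + 1)) k) ≤ (HomogeneousIdeal.irrelevant (MvPolynomial.homogeneousSubmodule (Fin (3 + 1)) O)).map φ), (∀ s, φ s = MvPolynomial.map θ s) →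
    ∀ (Ch : ∀ X' : AlgebraicGeometry.Scheme.{0}, (X' ⟶ (AlgebraicGeometry.Proj (MvPolynomial.homogeneousSubmodule (Fin (3 + 1)) O))) → Set X' → Prop),
      (∀ (X' X'' : AlgebraicGeometry.Scheme.{0}) (σ' : X' ⟶ (AlgebraicGeometry.Proj (MvPolynomial.homogeneousSubmodule (Fin (3 + 1)) O))) (S' : Set X') (C : X'.IdealSheafData) (τ : X'' ⟶ X'), Ch X' σ' S' → Literature.AlgebraicGeometry.Resolution.IsBlowup τ C →
        Literature.AlgebraicGeometry.Resolution.Scheme.IsRegular C.subscheme → AlgebraicGeometry.Flat (C.subschemeι ≫ σ' ≫ (AlgebraicGeometry.Proj.toSpecZero (MvPolynomial.homogeneousSubmodule (Fin (3 + 1)) O) ≫ AlgebraicGeometry.Spec.map (CommRingCat.ofHom (algebraMap O (MvPolynomial.homogeneousSubmodule (Fin (3 + 1)) O 0))))) → σ' '' (C.support : Set X') ⊆ {y | ¬ IsGenericPoint y (Set.range (ι ≫ AlgebraicGeometry.Proj.map φ hφ' : H ⟶ (AlgebraicGeometry.Proj (MvPolynomial.homogeneousSubmodule (Fin (3 + 1))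 O))))} →
        (C.support : Set X') ∩ (σ' ≫ (AlgebraicGeometry.Proj.toSpecZero (MvPolynomial.homogeneousSubmodule (Fin (3 + 1)) O) ≫ AlgebraicGeometry.Spec.map (CommRingCat.ofHom (algebraMap O (MvPolynomial.homogeneousSubmodule (Fin (3 + 1)) O 0))))) ⁻¹' {IsLocalRing.closedPoint O} ⊆ S' → Ch X'' (τ ≫ σ') (closure (τ ⁻¹' (S' \ (C.support : Set X'))))) → (∀ (X' : AlgebraicGeometry.Scheme.{0}) (σ' : X' ⟶ (AlgebraicGeometry.Proj (MvPolynomial.homogeneousSubmodule (Fin (3 + 1)) O))) (S' : Set X'), Ch X' σ' S' →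
        Summit.ResolutionOfSingularities.ResolutionOfSingularities.Theses.EquisingularLift.Split.Chain (AlgebraicGeometry.Proj (MvPolynomial.homogeneousSubmodule (Fin (3 + 1)) O)) (Set.range (ι ≫ AlgebraicGeometry.Proj.map φ hφ' : H ⟶ (AlgebraicGeometry.Proj (MvPolynomial.homogeneousSubmodule (Fin (3 + 1)) O)))) X' σ' S') → (Set.range (ι ≫ AlgebraicGeometry.Proj.map φ hφ' : H ⟶ (AlgebraicGeometry.Proj (MvPolynomial.homogeneousSubmodule (Fin (3 + 1)) O)))) ⊆ (AlgebraicGeometry.Proj.toSpecZero (MvPolynomial.homogeneousSubmodule (Fin (3 + 1)) O) ≫ AlgebraicGeometry.Spec.map (CommRingCat.ofHom (algebraMap O (MvPolynomial.homogeneousSubmodule (Fin (3 + 1)) O 0)))) ⁻¹' {IsLocalRing.closedPoint O} → IsIrreducible (Set.range (ι ≫ AlgebraicGeometry.Proj.map φ hφ' : H ⟶ (AlgebraicGeometry.Proj (MvPolynomial.homogeneousSubmodule (Fin (3 + 1)) O)))) → IsClosed (Set.range (ι ≫ AlgebraicGeometry.Proj.map φ hφ' : H ⟶ (AlgebraicGeometry.Proj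 (MvPolynomial.homogeneousSubmodule (Fin (3 + 1)) O)))) →
      AlgebraicGeometry.IsIntegral (AlgebraicGeometry.Proj (MvPolynomial.homogeneousSubmodule (Fin (3 + 1)) O)) → IsLocallyNoetherian (AlgebraicGeometry.Proj (MvPolynomial.homogeneousSubmodule (Fin (3 + 1)) O)) → Literature.AlgebraicGeometry.Resolution.Scheme.IsRegular (AlgebraicGeometry.Proj (MvPolynomial.homogeneousSubmodule (Fin (3 + 1)) O)) →
      -- the INITIAL stage is in the chain
      Ch (AlgebraicGeometry.Proj (MvPolynomial.homogeneousSubmodule (Fin (3 + 1)) O)) (𝟙 (AlgebraicGeometry.Proj (MvPolynomial.homogeneousSubmodule (Fin (3 + 1)) O))) (Set.range (ι ≫ AlgebraicGeometry.Proj.map φ hφ' : H ⟶ (AlgebraicGeometry.Proj (MvPolynomial.homogeneousSubmodule (Fin (3 + 1)) O)))) →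
    -- the door's point set `S ⊆ range ι` (`range ι ⊄ S`) and the PRESCRIBED SECTIONS `𝓢` (the slot's first half)
    ∀ (S : Set (Literature.AlgebraicGeometry.Motives.projectiveSpace 3 k).left) (hS : IsClosed S), S ⊆ Set.range ι → ¬ (Set.range ι ⊆ S) →
    ∀ (𝓢 : (AlgebraicGeometry.Proj (MvPolynomial.homogeneousSubmodule (Fin (3 + 1)) O)).IdealSheafData),
      Literature.AlgebraicGeometry.Resolution.Scheme.IsRegular 𝓢.subscheme →
      AlgebraicGeometry.Flat (𝓢.subschemeι ≫ (AlgebraicGeometry.Proj.toSpecZero (MvPolynomial.homogeneousSubmodule (Fin (3 + 1)) O) ≫ AlgebraicGeometry.Spec.map (CommRingCat.ofHom (algebraMap O (MvPolynomial.homogeneousSubmodule (Fin (3 + 1)) O 0))))) →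
      𝓢.comap (AlgebraicGeometry.Proj.map φ hφ') = vanishingIdeal (⟨S, hS⟩ : Closeds (Literature.AlgebraicGeometry.Motives.projectiveSpace 3 k).left) →
    -- the downstairs blow-up of `𝓘⟨S⟩` and the closed set `Z₂` of the next round
    ∀ (F₂ : Scheme.{0}) (υ : F₂ ⟶ (Literature.AlgebraicGeometry.Motives.projectiveSpace 3 k).left),
      IsBlowup υ (vanishingIdeal (⟨S, hS⟩ : Closeds (Literature.AlgebraicGeometry.Motives.projectiveSpace 3 k).left)) →
    ∀ (Z₂ : Set F₂) (hZ₂ : IsClosed Z₂),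
    -- the SLOT's second half: on every blow-up of `𝓢`, over every model square of `υ`, a regular `O`-flat centre with reduced trace `Z₂`
      (∀ (X₁ : Scheme.{0}) (τ : X₁ ⟶ (AlgebraicGeometry.Proj (MvPolynomial.homogeneousSubmodule (Fin (3 + 1)) O))), IsBlowup τ 𝓢 →
        ∀ (j₁ : F₂ ⟶ X₁) (t₁ : F₂ ⟶ Spec (.of k)),
          IsPullback j₁ t₁ (τ ≫ (AlgebraicGeometry.Proj.toSpecZero (MvPolynomial.homogeneousSubmodule (Fin (3 + 1)) O) ≫ AlgebraicGeometry.Spec.map (CommRingCat.ofHom (algebraMap O (MvPolynomial.homogeneousSubmodule (Fin (3 + 1)) O 0))))) (Spec.map (CommRingCat.ofHom θ)) →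
          j₁ ≫ τ = υ ≫ AlgebraicGeometry.Proj.map φ hφ' →
          ∃ C : X₁.IdealSheafData, Scheme.IsRegular C.subscheme ∧
            Flat (C.subschemeι ≫ τ ≫ (AlgebraicGeometry.Proj.toSpecZero (MvPolynomial.homogeneousSubmodule (Fin (3 + 1)) O) ≫ AlgebraicGeometry.Spec.map (CommRingCat.ofHom (algebraMap O (MvPolynomial.homogeneousSubmodule (Fin (3 + 1)) O 0))))) ∧
            C.comap j₁ = vanishingIdeal (⟨Z₂, hZ₂⟩ : Closeds F₂)) →
    ∃ (X₁ : Scheme.{0}) (σ₁ : X₁ ⟶ (AlgebraicGeometry.Proj (MvPolynomial.homogeneousSubmodule (Fin (3 + 1)) O))) (S₁ : Set X₁)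
      (j₁ : F₂ ⟶ X₁) (t₁ : F₂ ⟶ Spec (.of k)) (C : X₁.IdealSheafData),
      Ch X₁ σ₁ S₁ ∧ IsIntegral X₁ ∧ IsLocallyNoetherian X₁ ∧ Scheme.IsRegular X₁ ∧
      IsDominant (σ₁ ≫ (AlgebraicGeometry.Proj.toSpecZero (MvPolynomial.homogeneousSubmodule (Fin (3 + 1)) O) ≫ AlgebraicGeometry.Spec.map (CommRingCat.ofHom (algebraMap O (MvPolynomial.homogeneousSubmodule (Fin (3 + 1)) O 0))))) ∧
      IsIntegral F₂ ∧
      IsPullback j₁ t₁ (σ₁ ≫ (AlgebraicGeometry.Proj.toSpecZero (MvPolynomial.homogeneousSubmodule (Fin (3 + 1)) O) ≫ AlgebraicGeometry.Spec.map (CommRingCat.ofHom (algebraMap O (MvPolynomial.homogeneousSubmodule (Fin (3 + 1)) O 0))))) (Spec.map (CommRingCat.ofHom θ)) ∧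
      IsClosed (closure (υ ⁻¹' (Set.range ι \ S))) ∧ IsIrreducible (closure (υ ⁻¹' (Set.range ι \ S))) ∧ j₁ '' (closure (υ ⁻¹' (Set.range ι \ S))) = S₁ ∧
      Scheme.IsRegular C.subscheme ∧
      Flat (C.subschemeι ≫ σ₁ ≫ (AlgebraicGeometry.Proj.toSpecZero (MvPolynomial.homogeneousSubmodule (Fin (3 + 1)) O) ≫ AlgebraicGeometry.Spec.map (CommRingCat.ofHom (algebraMap O (MvPolynomial.homogeneousSubmodule (Fin (3 + 1)) O 0))))) ∧
      C.comap j₁ = vanishingIdeal (⟨Z₂, hZ₂⟩ : Closeds F₂) := by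
  classical
  letI := MvPolynomial.gradedAlgebra (σ := Fin (3 + 1)) (R := O)
  letI := MvPolynomial.gradedAlgebra (σ := Fin (3 + 1)) (R := k)
  intro φ hφ' hφ Ch hChStep hChSplit hYsp hYirr hYcl hPint hPnoeth hPreg hCh₀ S hS hST hTS 𝓢 h𝓢reg h𝓢fl h𝓢tr F₂ υ hυ Z₂ hZ₂ hslot
  -- the stage-generic step at the CONCRETE initial stage `(ℙ³_O, 𝟙, Y, Proj φ, t)` (✓ `hendBlock_stage_zero_of_model`'s bytes, model `𝓢` of `S`)
  refine sectionsStep_stage_of_model k O θ hθ _ _ _ Ch hChStep hChSplit hYsp hYirr hYcl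
    (Literature.AlgebraicGeometry.Motives.projectiveSpace 3 k).left (Set.range ι) S hS hST hTS F₂ υ hυ Z₂ hZ₂ ?_
  haveI := hι
  haveI := hH
  haveI := hPint
  have hF₁ : IsIntegral (Literature.AlgebraicGeometry.Motives.projectiveSpace 3 k).left := isIntegral_proj_homogeneousSubmodule 3 k
  have hT₁cl : IsClosed (Set.range ι) := ι.isClosedEmbedding.isClosed_range
  have hT₁irr : IsIrreducible (Set.range ι) := by
    have h := (IrreducibleSpace.isIrreducible_univ H).image ι ι.continuous.continuousOn
    rwa [Set.image_univ] at h
  -- the base model square and dominance of the initial stage (✓ `hendBlock_stage_zero_of_model`'s bytes)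
  have hP := ProjectiveAmbientFibre.isPullback_projMap θ φ hφ hθ hφ'
  have hsq₀ : IsPullback (AlgebraicGeometry.Proj.map φ hφ') (Proj.toSpecZero (homogeneousSubmodule (Fin (3 + 1)) k) ≫
      Spec.map (CommRingCat.ofHom (algebraMap k (homogeneousSubmodule (Fin (3 + 1)) k 0))))
      (𝟙 _ ≫ (AlgebraicGeometry.Proj.toSpecZero (MvPolynomial.homogeneousSubmodule (Fin (3 + 1)) O) ≫
        AlgebraicGeometry.Spec.map (CommRingCat.ofHom (algebraMap O (MvPolynomial.homogeneousSubmodule (Fin (3 + 1)) O 0)))))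
      (Spec.map (CommRingCat.ofHom θ)) := by
    rw [Category.id_comp]; exact hP
  obtain ⟨hsm, -⟩ := stub_projectiveAmbientSmoothProper O 3
  haveI : Nonempty H := inferInstance
  haveI : Nonempty (Proj (homogeneousSubmodule (Fin (3 + 1)) O)) := ⟨(AlgebraicGeometry.Proj.map φ hφ') (ι (Classical.arbitrary H))⟩
  haveI : Smooth (AlgebraicGeometry.Proj.toSpecZero (MvPolynomial.homogeneousSubmodule (Fin (3 + 1)) O) ≫
      AlgebraicGeometry.Spec.map (CommRingCat.ofHom (algebraMap O (MvPolynomial.homogeneousSubmodule (Fin (3 + 1)) O 0)))) := hsm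
  haveI : IsDominant (AlgebraicGeometry.Proj.toSpecZero (MvPolynomial.homogeneousSubmodule (Fin (3 + 1)) O) ≫
      AlgebraicGeometry.Spec.map (CommRingCat.ofHom (algebraMap O (MvPolynomial.homogeneousSubmodule (Fin (3 + 1)) O 0)))) :=
    isDominant_of_smooth_of_nonempty _
  have hdom₀ : IsDominant (𝟙 (Proj (homogeneousSubmodule (Fin (3 + 1)) O)) ≫
      (AlgebraicGeometry.Proj.toSpecZero (MvPolynomial.homogeneousSubmodule (Fin (3 + 1)) O) ≫
        AlgebraicGeometry.Spec.map (CommRingCat.ofHom (algebraMap O (MvPolynomial.homogeneousSubmodule (Fin (3 + 1)) O 0))))) := by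
    rw [Category.id_comp]; infer_instance
  have hfl' : Flat (𝓢.subschemeι ≫ 𝟙 (Proj (homogeneousSubmodule (Fin (3 + 1)) O)) ≫
      (AlgebraicGeometry.Proj.toSpecZero (MvPolynomial.homogeneousSubmodule (Fin (3 + 1)) O) ≫
        AlgebraicGeometry.Spec.map (CommRingCat.ofHom (algebraMap O (MvPolynomial.homogeneousSubmodule (Fin (3 + 1)) O 0))))) := by
    rw [Category.id_comp]; exact h𝓢fl
  have hrange : (AlgebraicGeometry.Proj.map φ hφ') '' Set.range ι =
      Set.range (ι ≫ AlgebraicGeometry.Proj.map φ hφ' : H ⟶ (AlgebraicGeometry.Proj (MvPolynomial.homogeneousSubmodule (Fin (3 + 1)) O))) := by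
    rw [← Set.range_comp]; rfl
  refine ⟨_, 𝟙 _, _, AlgebraicGeometry.Proj.map φ hφ', _, 𝓢, hCh₀, hPint, hPnoeth, hPreg, hdom₀, hF₁, hsq₀, hT₁cl, hT₁irr, hrange, h𝓢reg, hfl', h𝓢tr, ?_⟩
  -- the slot, re-associated to the packed stage's shape (`σ' := 𝟙`)
  intro X₁ τ hτ j₁ t₁ hsq₁ hcomm₁
  have hsq₁' : IsPullback j₁ t₁ (τ ≫ (AlgebraicGeometry.Proj.toSpecZero (MvPolynomial.homogeneousSubmodule (Fin (3 + 1)) O) ≫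
      AlgebraicGeometry.Spec.map (CommRingCat.ofHom (algebraMap O (MvPolynomial.homogeneousSubmodule (Fin (3 + 1)) O 0))))) (Spec.map (CommRingCat.ofHom θ)) := by
    simpa only [Category.comp_id, Category.assoc] using hsq₁
  obtain ⟨C, hCreg, hCfl, hCj⟩ := hslot X₁ τ hτ j₁ t₁ hsq₁' hcomm₁
  exact ⟨C, hCreg, by simpa only [Category.comp_id, Category.assoc] using hCfl, hCj⟩

/-- ★ **THE ν-LIFT NOSE MOVE AT THE INITIAL STAGE, UPSTAIRS — the COMPOSITE over the B‴ tail of record** (D15 engine (E1), scratch): PRESCRIBED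
SECTIONS `𝓢` of `S ⊆ range ι`, the downstairs blow-up `υ` of `𝓘⟨S⟩`, the strict-transform nose `Z₂ ⊆ T₂ := closure (υ ⁻¹' (range ι ∖ S))` (door clauses:
`T₂ ⊄ Z₂`, infinite, curve clause), the slot's centre promise, the nose blow-up `υ'` of `𝓘⟨Z₂⟩` and a B‴ tail ⇒ the new upstairs stage in HSUBʰ/HSUBⁱ
currency with the host dropped.  = `sectionsStep_stage_zero_of_model` then ✓ `Equinodal.noseRound_stage_of_model` (PHASE 2).  The D15 door's ΣPG tail:
swap in `noseRound_stage_of_model_sigmaPG` (res-L1-w45b-stub-2 (3′)).  Conditional on (T-k) through the tail, as every nose rung.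
[OURS · L1 W4.5b · D15 engine (E1), scratch; counted 0; EL♮(3) NOT proved] -/
theorem liftNose_stage_zero_of_model (hF : EmbeddedCurveLiftFact) (k : Type) [Field k] [IsAlgClosed k] (H : Scheme.{0})
    (ι : H ⟶ (Literature.AlgebraicGeometry.Motives.projectiveSpace 3 k).left)
    (hι : AlgebraicGeometry.IsClosedImmersion ι) (hH : AlgebraicGeometry.IsIntegral H)
    (O : Type) [CommRing O] [IsDomain O] [IsDiscreteValuationRing O] [IsAdicComplete (IsLocalRing.maximalIdeal O) O]
    [IsAlgClosed (IsLocalRing.ResidueField O)] (θ : O →+* k) (hθ : Function.Surjective θ) :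
    letI := MvPolynomial.gradedAlgebra (σ := Fin (3 + 1)) (R := O); letI := MvPolynomial.gradedAlgebra (σ := Fin (3 + 1)) (R := k);
    ∀ (φ : MvPolynomial.homogeneousSubmodule (Fin (3 + 1)) O →+*ᵍ MvPolynomial.homogeneousSubmodule (Fin (3 + 1)) k)
      (hφ' : HomogeneousIdeal.irrelevant (MvPolynomial.homogeneousSubmodule (Fin (3 + 1)) k) ≤ (HomogeneousIdeal.irrelevant (MvPolynomial.homogeneousSubmodule (Fin (3 + 1)) O)).map φ), (∀ s, φ s = MvPolynomial.map θ s) →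
    ∀ (Ch : ∀ X' : AlgebraicGeometry.Scheme.{0}, (X' ⟶ (AlgebraicGeometry.Proj (MvPolynomial.homogeneousSubmodule (Fin (3 + 1)) O))) → Set X' → Prop),
      (∀ (X' X'' : AlgebraicGeometry.Scheme.{0}) (σ' : X' ⟶ (AlgebraicGeometry.Proj (MvPolynomial.homogeneousSubmodule (Fin (3 + 1)) O))) (S' : Set X') (C : X'.IdealSheafData) (τ : X'' ⟶ X'), Ch X' σ' S' → Literature.AlgebraicGeometry.Resolution.IsBlowup τ C →
        Literature.AlgebraicGeometry.Resolution.Scheme.IsRegular C.subscheme → AlgebraicGeometry.Flat (C.subschemeι ≫ σ' ≫ (AlgebraicGeometry.Proj.toSpecZero (MvPolynomial.homogeneousSubmodule (Fin (3 + 1)) O) ≫ AlgebraicGeometry.Spec.map (CommRingCat.ofHom (algebraMap O (MvPolynomial.homogeneousSubmodule (Fin (3 + 1)) O 0))))) → σ' '' (C.support : Set X') ⊆ {y | ¬ IsGenericPoint y (Set.range (ι ≫ AlgebraicGeometry.Proj.map φ hφ' : H ⟶ (AlgebraicGeometry.Proj (MvPolynomial.homogeneousSubmodule (Fin (3 + 1))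 O))))} →
        (C.support : Set X') ∩ (σ' ≫ (AlgebraicGeometry.Proj.toSpecZero (MvPolynomial.homogeneousSubmodule (Fin (3 + 1)) O) ≫ AlgebraicGeometry.Spec.map (CommRingCat.ofHom (algebraMap O (MvPolynomial.homogeneousSubmodule (Fin (3 + 1)) O 0))))) ⁻¹' {IsLocalRing.closedPoint O} ⊆ S' → Ch X'' (τ ≫ σ') (closure (τ ⁻¹' (S' \ (C.support : Set X'))))) → (∀ (X' : AlgebraicGeometry.Scheme.{0}) (σ' : X' ⟶ (AlgebraicGeometry.Proj (MvPolynomial.homogeneousSubmodule (Fin (3 + 1)) O))) (S' : Set X'), Ch X' σ' S' →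
        Summit.ResolutionOfSingularities.ResolutionOfSingularities.Theses.EquisingularLift.Split.Chain (AlgebraicGeometry.Proj (MvPolynomial.homogeneousSubmodule (Fin (3 + 1)) O)) (Set.range (ι ≫ AlgebraicGeometry.Proj.map φ hφ' : H ⟶ (AlgebraicGeometry.Proj (MvPolynomial.homogeneousSubmodule (Fin (3 + 1)) O)))) X' σ' S') → (Set.range (ι ≫ AlgebraicGeometry.Proj.map φ hφ' : H ⟶ (AlgebraicGeometry.Proj (MvPolynomial.homogeneousSubmodule (Fin (3 + 1)) O)))) ⊆ (AlgebraicGeometry.Proj.toSpecZero (MvPolynomial.homogeneousSubmodule (Fin (3 + 1)) O) ≫ AlgebraicGeometry.Spec.map (CommRingCat.ofHom (algebraMap O (MvPolynomial.homogeneousSubmodule (Fin (3 + 1)) O 0)))) ⁻¹' {IsLocalRing.closedPoint O} → IsIrreducible (Set.range (ι ≫ AlgebraicGeometry.Proj.map φ hφ' : H ⟶ (AlgebraicGeometry.Proj (MvPolynomial.homogeneousSubmodule (Fin (3 + 1)) O)))) → IsClosed (Set.range (ι ≫ AlgebraicGeometry.Proj.map φ hφ' : H ⟶ (AlgebraicGeometry.Proj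 (MvPolynomial.homogeneousSubmodule (Fin (3 + 1)) O)))) →
      AlgebraicGeometry.IsIntegral (AlgebraicGeometry.Proj (MvPolynomial.homogeneousSubmodule (Fin (3 + 1)) O)) → IsLocallyNoetherian (AlgebraicGeometry.Proj (MvPolynomial.homogeneousSubmodule (Fin (3 + 1)) O)) → Literature.AlgebraicGeometry.Resolution.Scheme.IsRegular (AlgebraicGeometry.Proj (MvPolynomial.homogeneousSubmodule (Fin (3 + 1)) O)) → AlgebraicGeometry.IsProper (AlgebraicGeometry.Proj.toSpecZero (MvPolynomial.homogeneousSubmodule (Fin (3 + 1)) O) ≫ AlgebraicGeometry.Spec.map (CommRingCat.ofHom (algebraMap O (MvPolynomial.homogeneousSubmodule (Fin (3 + 1)) O 0)))) → AlgebraicGeometry.SmoothOfRelativeDimension 3 (AlgebraicGeometry.Proj.toSpecZero (MvPolynomial.homogeneousSubmodule (Fin (3 + 1)) O) ≫ AlgebraicGeometry.Spec.map (CommRingCat.ofHom (algebraMap O (MvPolynomial.homogeneousSubmodule (Fin (3 + 1)) O 0)))) →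
      -- the INITIAL stage is in the chain
      Ch (AlgebraicGeometry.Proj (MvPolynomial.homogeneousSubmodule (Fin (3 + 1)) O)) (𝟙 (AlgebraicGeometry.Proj (MvPolynomial.homogeneousSubmodule (Fin (3 + 1)) O))) (Set.range (ι ≫ AlgebraicGeometry.Proj.map φ hφ' : H ⟶ (AlgebraicGeometry.Proj (MvPolynomial.homogeneousSubmodule (Fin (3 + 1)) O)))) →
    -- the door's point set `S ⊆ range ι` (`range ι ⊄ S`) and the PRESCRIBED SECTIONS `𝓢` (the slot's first half)
    ∀ (S : Set (Literature.AlgebraicGeometry.Motives.projectiveSpace 3 k).left) (hS : IsClosed S), S ⊆ Set.range ι → ¬ (Set.range ι ⊆ S) →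
    ∀ (𝓢 : (AlgebraicGeometry.Proj (MvPolynomial.homogeneousSubmodule (Fin (3 + 1)) O)).IdealSheafData),
      Literature.AlgebraicGeometry.Resolution.Scheme.IsRegular 𝓢.subscheme →
      AlgebraicGeometry.Flat (𝓢.subschemeι ≫ (AlgebraicGeometry.Proj.toSpecZero (MvPolynomial.homogeneousSubmodule (Fin (3 + 1)) O) ≫ AlgebraicGeometry.Spec.map (CommRingCat.ofHom (algebraMap O (MvPolynomial.homogeneousSubmodule (Fin (3 + 1)) O 0))))) →
      𝓢.comap (AlgebraicGeometry.Proj.map φ hφ') = vanishingIdeal (⟨S, hS⟩ : Closeds (Literature.AlgebraicGeometry.Motives.projectiveSpace 3 k).left) →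
    -- the downstairs blow-up of `𝓘⟨S⟩` and the strict-transform NOSE `Z₂ ⊆ T₂ := closure (υ ⁻¹' (range ι ∖ S))` (door clauses at the new stage)
    ∀ (F₂ : Scheme.{0}) (υ : F₂ ⟶ (Literature.AlgebraicGeometry.Motives.projectiveSpace 3 k).left),
      IsBlowup υ (vanishingIdeal (⟨S, hS⟩ : Closeds (Literature.AlgebraicGeometry.Motives.projectiveSpace 3 k).left)) →
    ∀ (Z₂ : Set F₂) (hZ₂ : IsClosed Z₂), Z₂ ⊆ (closure (υ ⁻¹' (Set.range ι \ S))) → ¬ ((closure (υ ⁻¹' (Set.range ι \ S))) ⊆ Z₂) → Z₂.Infinite →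
      (∀ z : ↥(redSub F₂ Z₂ hZ₂), IsClosed ({z} : Set ↥(redSub F₂ Z₂ hZ₂)) → ringKrullDim ((redSub F₂ Z₂ hZ₂).presheaf.stalk z) = ((1 : ℕ) : WithBot ℕ∞)) →
    -- the SLOT's second half: on every blow-up of `𝓢`, over every model square of `υ`, a regular `O`-flat centre with reduced trace `Z₂`
      (∀ (X₁ : Scheme.{0}) (τ : X₁ ⟶ (AlgebraicGeometry.Proj (MvPolynomial.homogeneousSubmodule (Fin (3 + 1)) O))), IsBlowup τ 𝓢 →
        ∀ (j₁ : F₂ ⟶ X₁) (t₁ : F₂ ⟶ Spec (.of k)),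
          IsPullback j₁ t₁ (τ ≫ (AlgebraicGeometry.Proj.toSpecZero (MvPolynomial.homogeneousSubmodule (Fin (3 + 1)) O) ≫ AlgebraicGeometry.Spec.map (CommRingCat.ofHom (algebraMap O (MvPolynomial.homogeneousSubmodule (Fin (3 + 1)) O 0))))) (Spec.map (CommRingCat.ofHom θ)) →
          j₁ ≫ τ = υ ≫ AlgebraicGeometry.Proj.map φ hφ' →
          ∃ C : X₁.IdealSheafData, Scheme.IsRegular C.subscheme ∧
            Flat (C.subschemeι ≫ τ ≫ (AlgebraicGeometry.Proj.toSpecZero (MvPolynomial.homogeneousSubmodule (Fin (3 + 1)) O) ≫ AlgebraicGeometry.Spec.map (CommRingCat.ofHom (algebraMap O (MvPolynomial.homogeneousSubmodule (Fin (3 + 1)) O 0))))) ∧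
            C.comap j₁ = vanishingIdeal (⟨Z₂, hZ₂⟩ : Closeds F₂)) →
    -- THE MOVE: the nose blow-up at the new stage and the B‴ tail (door clauses verbatim at `(F₂, T₂, Z₂)`)
    ∀ (F₃ : Scheme.{0}) (υ' : F₃ ⟶ F₂), IsBlowup υ' (vanishingIdeal (⟨Z₂, hZ₂⟩ : Closeds F₂)) →
    ∀ (F₉ : Scheme.{0}) (γ' : F₉ ⟶ F₃) (T₉ E' : Set F₉) (Es' Ns' : List (Set F₉)) (K' : Set F₉),
      (∀ R : (∀ G : Scheme.{0}, (G ⟶ F₃) → Set G → Set G → List (Set G) → List (Set G) → Set G → Prop),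
        R F₃ (𝟙 F₃) (closure (υ' ⁻¹' ((closure (υ ⁻¹' (Set.range ι \ S))) \ Z₂))) (υ' ⁻¹' Z₂) [] [] ∅ →
        TowerPtRegB₄ F₃ R → TowerPtRamB₄ F₃ R → TowerRoundBTriplePrime F₂ F₃ υ' Z₂ hZ₂ R →
        R F₉ γ' T₉ E' Es' Ns' K') →
    ∃ (X₉ : Scheme.{0}) (σ₉ : X₉ ⟶ (AlgebraicGeometry.Proj (MvPolynomial.homogeneousSubmodule (Fin (3 + 1)) O))) (S₉ : Set X₉) (j₉ : F₉ ⟶ X₉) (t₉ : F₉ ⟶ AlgebraicGeometry.Spec (.of k)),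
      Ch X₉ σ₉ S₉ ∧ AlgebraicGeometry.IsIntegral X₉ ∧ IsLocallyNoetherian X₉ ∧ Literature.AlgebraicGeometry.Resolution.Scheme.IsRegular X₉ ∧ AlgebraicGeometry.IsDominant (σ₉ ≫ (AlgebraicGeometry.Proj.toSpecZero (MvPolynomial.homogeneousSubmodule (Fin (3 + 1)) O) ≫ AlgebraicGeometry.Spec.map (CommRingCat.ofHom (algebraMap O (MvPolynomial.homogeneousSubmodule (Fin (3 + 1)) O 0))))) ∧
      IsPullback j₉ t₉ (σ₉ ≫ (AlgebraicGeometry.Proj.toSpecZero (MvPolynomial.homogeneousSubmodule (Fin (3 + 1)) O) ≫ AlgebraicGeometry.Spec.map (CommRingCat.ofHom (algebraMap O (MvPolynomial.homogeneousSubmodule (Fin (3 + 1)) O 0))))) (AlgebraicGeometry.Spec.map (CommRingCat.ofHom θ)) ∧ j₉ '' T₉ = S₉ ∧ IsClosed T₉ ∧ IsIrreducible T₉ ∧ AlgebraicGeometry.IsIntegral F₉ ∧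
      TCPlus.LetterDatum O (AlgebraicGeometry.Proj (MvPolynomial.homogeneousSubmodule (Fin (3 + 1)) O)) (AlgebraicGeometry.Proj.toSpecZero (MvPolynomial.homogeneousSubmodule (Fin (3 + 1)) O) ≫ AlgebraicGeometry.Spec.map (CommRingCat.ofHom (algebraMap O (MvPolynomial.homogeneousSubmodule (Fin (3 + 1)) O 0)))) (Set.range (ι ≫ AlgebraicGeometry.Proj.map φ hφ' : H ⟶ (AlgebraicGeometry.Proj (MvPolynomial.homogeneousSubmodule (Fin (3 + 1)) O)))) F₉ X₉ σ₉ j₉ (∅ : Set F₉) := by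
  classical
  letI := MvPolynomial.gradedAlgebra (σ := Fin (3 + 1)) (R := O)
  letI := MvPolynomial.gradedAlgebra (σ := Fin (3 + 1)) (R := k)
  intro φ hφ' hφ Ch hChStep hChSplit hYsp hYirr hYcl hPint hPnoeth hPreg hqprop hqsm hCh₀ S hS hST hTS 𝓢 h𝓢reg h𝓢fl h𝓢tr F₂ υ hυ Z₂ hZ₂ hZ₂T hT₂Z
    hZ₂inf hZ₂dim hslot F₃ υ' hυ' F₉ γ' T₉ E' Es' Ns' K' htail
  -- the SECTIONS STEP: the chain stage at `Bl_𝓢 ℙ³_O` over `F₂ = Bl_S ℙ³_k` carrying the slot's centre of `Z₂` …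
  have hmodel := sectionsStep_stage_zero_of_model k H ι hι hH O θ hθ φ hφ' hφ Ch hChStep hChSplit hYsp hYirr hYcl hPint hPnoeth hPreg hCh₀ S hS hST
    hTS 𝓢 h𝓢reg h𝓢fl h𝓢tr F₂ υ hυ Z₂ hZ₂ hslot
  -- … then PHASE 2 (✓ `Equinodal.noseRound_stage_of_model`) at `(F₂, T₂, Z₂)`
  exact Equinodal.noseRound_stage_of_model hF k O θ hθ _ _ _ Ch hChStep hChSplit hYsp hYirr hYcl hPint hPnoeth hPreg hqprop hqsm
    F₂ (closure (υ ⁻¹' (Set.range ι \ S))) Z₂ hZ₂ hZ₂T hT₂Z hZ₂inf hZ₂dim hmodel F₃ υ' hυ' F₉ γ' T₉ E' Es' Ns' K' htail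

/-- ★★ **THE ν-LIFT NOSE MOVE AT THE INITIAL STAGE, KEYED TO THE DOOR'S LETTERS** (D15 engine (E1), scratch): as `liftNose_stage_zero_of_model`, but the
nose letters at the new stage are DERIVED from the door's letters for `Z` — `Z₂ ⊆ T₂` (monotonicity), `T₂ ⊄ Z₂` (a point of `range ι ∖ Z` lifts, the blow-up
being onto off `S`, Literature `IsBlowup.exists_preimage_of_notMem_support`), `Z₂` infinite (`Z ∖ S` is infinite for FINITE `S` and is the image of
`υ ⁻¹' (Z ∖ S)`) — except the CURVE CLAUSE for `Z̃₂`, kept as the ONE new-stage letter (precedent: ✓ `ReachEquinodalPlanarNose₂` carries it; by-type Q to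
the desk/typer STATUS 2026-08-29T10:24:22Z). [OURS · L1 W4.5b · D15 engine (E1), scratch; counted 0; EL♮(3) NOT proved] -/
theorem liftNose_stage_zero_of_letters (hF : EmbeddedCurveLiftFact) (k : Type) [Field k] [IsAlgClosed k] (H : Scheme.{0})
    (ι : H ⟶ (Literature.AlgebraicGeometry.Motives.projectiveSpace 3 k).left)
    (hι : AlgebraicGeometry.IsClosedImmersion ι) (hH : AlgebraicGeometry.IsIntegral H)
    (O : Type) [CommRing O] [IsDomain O] [IsDiscreteValuationRing O] [IsAdicComplete (IsLocalRing.maximalIdeal O) O]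
    [IsAlgClosed (IsLocalRing.ResidueField O)] (θ : O →+* k) (hθ : Function.Surjective θ) :
    letI := MvPolynomial.gradedAlgebra (σ := Fin (3 + 1)) (R := O); letI := MvPolynomial.gradedAlgebra (σ := Fin (3 + 1)) (R := k);
    ∀ (φ : MvPolynomial.homogeneousSubmodule (Fin (3 + 1)) O →+*ᵍ MvPolynomial.homogeneousSubmodule (Fin (3 + 1)) k)
      (hφ' : HomogeneousIdeal.irrelevant (MvPolynomial.homogeneousSubmodule (Fin (3 + 1)) k) ≤ (HomogeneousIdeal.irrelevant (MvPolynomial.homogeneousSubmodule (Fin (3 + 1)) O)).map φ), (∀ s, φ s = MvPolynomial.map θ s) →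
    ∀ (Ch : ∀ X' : AlgebraicGeometry.Scheme.{0}, (X' ⟶ (AlgebraicGeometry.Proj (MvPolynomial.homogeneousSubmodule (Fin (3 + 1)) O))) → Set X' → Prop),
      (∀ (X' X'' : AlgebraicGeometry.Scheme.{0}) (σ' : X' ⟶ (AlgebraicGeometry.Proj (MvPolynomial.homogeneousSubmodule (Fin (3 + 1)) O))) (S' : Set X') (C : X'.IdealSheafData) (τ : X'' ⟶ X'), Ch X' σ' S' → Literature.AlgebraicGeometry.Resolution.IsBlowup τ C →
        Literature.AlgebraicGeometry.Resolution.Scheme.IsRegular C.subscheme → AlgebraicGeometry.Flat (C.subschemeι ≫ σ' ≫ (AlgebraicGeometry.Proj.toSpecZero (MvPolynomial.homogeneousSubmodule (Fin (3 + 1)) O) ≫ AlgebraicGeometry.Spec.map (CommRingCat.ofHom (algebraMap O (MvPolynomial.homogeneousSubmodule (Fin (3 + 1)) O 0))))) → σ' '' (C.support : Set X') ⊆ {y | ¬ IsGenericPoint y (Set.range (ι ≫ AlgebraicGeometry.Proj.map φ hφ' : H ⟶ (AlgebraicGeometry.Proj (MvPolynomial.homogeneousSubmodule (Fin (3 + 1))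 O))))} →
        (C.support : Set X') ∩ (σ' ≫ (AlgebraicGeometry.Proj.toSpecZero (MvPolynomial.homogeneousSubmodule (Fin (3 + 1)) O) ≫ AlgebraicGeometry.Spec.map (CommRingCat.ofHom (algebraMap O (MvPolynomial.homogeneousSubmodule (Fin (3 + 1)) O 0))))) ⁻¹' {IsLocalRing.closedPoint O} ⊆ S' → Ch X'' (τ ≫ σ') (closure (τ ⁻¹' (S' \ (C.support : Set X'))))) → (∀ (X' : AlgebraicGeometry.Scheme.{0}) (σ' : X' ⟶ (AlgebraicGeometry.Proj (MvPolynomial.homogeneousSubmodule (Fin (3 + 1)) O))) (S' : Set X'), Ch X' σ' S' →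
        Summit.ResolutionOfSingularities.ResolutionOfSingularities.Theses.EquisingularLift.Split.Chain (AlgebraicGeometry.Proj (MvPolynomial.homogeneousSubmodule (Fin (3 + 1)) O)) (Set.range (ι ≫ AlgebraicGeometry.Proj.map φ hφ' : H ⟶ (AlgebraicGeometry.Proj (MvPolynomial.homogeneousSubmodule (Fin (3 + 1)) O)))) X' σ' S') → (Set.range (ι ≫ AlgebraicGeometry.Proj.map φ hφ' : H ⟶ (AlgebraicGeometry.Proj (MvPolynomial.homogeneousSubmodule (Fin (3 + 1)) O)))) ⊆ (AlgebraicGeometry.Proj.toSpecZero (MvPolynomial.homogeneousSubmodule (Fin (3 + 1)) O) ≫ AlgebraicGeometry.Spec.map (CommRingCat.ofHom (algebraMap O (MvPolynomial.homogeneousSubmodule (Fin (3 + 1)) O 0)))) ⁻¹' {IsLocalRing.closedPoint O} → IsIrreducible (Set.range (ι ≫ AlgebraicGeometry.Proj.map φ hφ' : H ⟶ (AlgebraicGeometry.Proj (MvPolynomial.homogeneousSubmodule (Fin (3 + 1)) O)))) → IsClosed (Set.range (ι ≫ AlgebraicGeometry.Proj.map φ hφ' : H ⟶ (AlgebraicGeometry.Proj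 (MvPolynomial.homogeneousSubmodule (Fin (3 + 1)) O)))) →
      AlgebraicGeometry.IsIntegral (AlgebraicGeometry.Proj (MvPolynomial.homogeneousSubmodule (Fin (3 + 1)) O)) → IsLocallyNoetherian (AlgebraicGeometry.Proj (MvPolynomial.homogeneousSubmodule (Fin (3 + 1)) O)) → Literature.AlgebraicGeometry.Resolution.Scheme.IsRegular (AlgebraicGeometry.Proj (MvPolynomial.homogeneousSubmodule (Fin (3 + 1)) O)) → AlgebraicGeometry.IsProper (AlgebraicGeometry.Proj.toSpecZero (MvPolynomial.homogeneousSubmodule (Fin (3 + 1)) O) ≫ AlgebraicGeometry.Spec.map (CommRingCat.ofHom (algebraMap O (MvPolynomial.homogeneousSubmodule (Fin (3 + 1)) O 0)))) → AlgebraicGeometry.SmoothOfRelativeDimension 3 (AlgebraicGeometry.Proj.toSpecZero (MvPolynomial.homogeneousSubmodule (Fin (3 + 1)) O) ≫ AlgebraicGeometry.Spec.map (CommRingCat.ofHom (algebraMap O (MvPolynomial.homogeneousSubmodule (Fin (3 + 1)) O 0)))) →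
      -- the INITIAL stage is in the chain
      Ch (AlgebraicGeometry.Proj (MvPolynomial.homogeneousSubmodule (Fin (3 + 1)) O)) (𝟙 (AlgebraicGeometry.Proj (MvPolynomial.homogeneousSubmodule (Fin (3 + 1)) O))) (Set.range (ι ≫ AlgebraicGeometry.Proj.map φ hφ' : H ⟶ (AlgebraicGeometry.Proj (MvPolynomial.homogeneousSubmodule (Fin (3 + 1)) O)))) →
    -- the door's NOSE `Z ⊆ range ι` (`range ι ⊄ Z`, infinite) and its FINITE closed point set `S ⊆ Z` (door letters; `S = ∅` allowed)
    ∀ (Z : Set (Literature.AlgebraicGeometry.Motives.projectiveSpace 3 k).left) (hZ : IsClosed Z), Z ⊆ Set.range ι → ¬ (Set.range ι ⊆ Z) → Z.Infinite →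
    ∀ (S : Set (Literature.AlgebraicGeometry.Motives.projectiveSpace 3 k).left) (hS : IsClosed S), S ⊆ Z → S.Finite →
    -- the PRESCRIBED SECTIONS `𝓢` (the slot's first half)
    ∀ (𝓢 : (AlgebraicGeometry.Proj (MvPolynomial.homogeneousSubmodule (Fin (3 + 1)) O)).IdealSheafData),
      Literature.AlgebraicGeometry.Resolution.Scheme.IsRegular 𝓢.subscheme →
      AlgebraicGeometry.Flat (𝓢.subschemeι ≫ (AlgebraicGeometry.Proj.toSpecZero (MvPolynomial.homogeneousSubmodule (Fin (3 + 1)) O) ≫ AlgebraicGeometry.Spec.map (CommRingCat.ofHom (algebraMap O (MvPolynomial.homogeneousSubmodule (Fin (3 + 1)) O 0))))) →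
      𝓢.comap (AlgebraicGeometry.Proj.map φ hφ') = vanishingIdeal (⟨S, hS⟩ : Closeds (Literature.AlgebraicGeometry.Motives.projectiveSpace 3 k).left) →
    -- the downstairs blow-up of `𝓘⟨S⟩`
    ∀ (F₂ : Scheme.{0}) (υ : F₂ ⟶ (Literature.AlgebraicGeometry.Motives.projectiveSpace 3 k).left),
      IsBlowup υ (vanishingIdeal (⟨S, hS⟩ : Closeds (Literature.AlgebraicGeometry.Motives.projectiveSpace 3 k).left)) →
    -- ONE letter at the new stage: the CURVE CLAUSE for the strict transform `Z₂ := closure (υ ⁻¹' (Z ∖ S))` (the other three nose letters are derived)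
      (∀ z : ↥(redSub F₂ (closure (υ ⁻¹' (Z \ S))) isClosed_closure), IsClosed ({z} : Set ↥(redSub F₂ (closure (υ ⁻¹' (Z \ S))) isClosed_closure)) →
        ringKrullDim ((redSub F₂ (closure (υ ⁻¹' (Z \ S))) isClosed_closure).presheaf.stalk z) = ((1 : ℕ) : WithBot ℕ∞)) →
    -- the SLOT's second half: on every blow-up of `𝓢`, over every model square of `υ`, a regular `O`-flat centre with reduced trace `closure (υ ⁻¹' (Z ∖ S))`
      (∀ (X₁ : Scheme.{0}) (τ : X₁ ⟶ (AlgebraicGeometry.Proj (MvPolynomial.homogeneousSubmodule (Fin (3 + 1)) O))), IsBlowup τ 𝓢 →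
        ∀ (j₁ : F₂ ⟶ X₁) (t₁ : F₂ ⟶ Spec (.of k)),
          IsPullback j₁ t₁ (τ ≫ (AlgebraicGeometry.Proj.toSpecZero (MvPolynomial.homogeneousSubmodule (Fin (3 + 1)) O) ≫ AlgebraicGeometry.Spec.map (CommRingCat.ofHom (algebraMap O (MvPolynomial.homogeneousSubmodule (Fin (3 + 1)) O 0))))) (Spec.map (CommRingCat.ofHom θ)) →
          j₁ ≫ τ = υ ≫ AlgebraicGeometry.Proj.map φ hφ' →
          ∃ C : X₁.IdealSheafData, Scheme.IsRegular C.subscheme ∧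
            Flat (C.subschemeι ≫ τ ≫ (AlgebraicGeometry.Proj.toSpecZero (MvPolynomial.homogeneousSubmodule (Fin (3 + 1)) O) ≫ AlgebraicGeometry.Spec.map (CommRingCat.ofHom (algebraMap O (MvPolynomial.homogeneousSubmodule (Fin (3 + 1)) O 0))))) ∧
            C.comap j₁ = vanishingIdeal (⟨closure (υ ⁻¹' (Z \ S)), isClosed_closure⟩ : Closeds F₂)) →
    -- THE MOVE: the nose blow-up at the new stage and the B‴ tail (door clauses verbatim at `(F₂, T₂, Z₂)`)
    ∀ (F₃ : Scheme.{0}) (υ' : F₃ ⟶ F₂), IsBlowup υ' (vanishingIdeal (⟨closure (υ ⁻¹' (Z \ S)), isClosed_closure⟩ : Closeds F₂)) →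
    ∀ (F₉ : Scheme.{0}) (γ' : F₉ ⟶ F₃) (T₉ E' : Set F₉) (Es' Ns' : List (Set F₉)) (K' : Set F₉),
      (∀ R : (∀ G : Scheme.{0}, (G ⟶ F₃) → Set G → Set G → List (Set G) → List (Set G) → Set G → Prop),
        R F₃ (𝟙 F₃) (closure (υ' ⁻¹' ((closure (υ ⁻¹' (Set.range ι \ S))) \ (closure (υ ⁻¹' (Z \ S)))))) (υ' ⁻¹' (closure (υ ⁻¹' (Z \ S)))) [] [] ∅ →
        TowerPtRegB₄ F₃ R → TowerPtRamB₄ F₃ R → TowerRoundBTriplePrime F₂ F₃ υ' (closure (υ ⁻¹' (Z \ S))) isClosed_closure R →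
        R F₉ γ' T₉ E' Es' Ns' K') →
    ∃ (X₉ : Scheme.{0}) (σ₉ : X₉ ⟶ (AlgebraicGeometry.Proj (MvPolynomial.homogeneousSubmodule (Fin (3 + 1)) O))) (S₉ : Set X₉) (j₉ : F₉ ⟶ X₉) (t₉ : F₉ ⟶ AlgebraicGeometry.Spec (.of k)),
      Ch X₉ σ₉ S₉ ∧ AlgebraicGeometry.IsIntegral X₉ ∧ IsLocallyNoetherian X₉ ∧ Literature.AlgebraicGeometry.Resolution.Scheme.IsRegular X₉ ∧ AlgebraicGeometry.IsDominant (σ₉ ≫ (AlgebraicGeometry.Proj.toSpecZero (MvPolynomial.homogeneousSubmodule (Fin (3 + 1)) O) ≫ AlgebraicGeometry.Spec.map (CommRingCat.ofHom (algebraMap O (MvPolynomial.homogeneousSubmodule (Fin (3 + 1)) O 0))))) ∧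
      IsPullback j₉ t₉ (σ₉ ≫ (AlgebraicGeometry.Proj.toSpecZero (MvPolynomial.homogeneousSubmodule (Fin (3 + 1)) O) ≫ AlgebraicGeometry.Spec.map (CommRingCat.ofHom (algebraMap O (MvPolynomial.homogeneousSubmodule (Fin (3 + 1)) O 0))))) (AlgebraicGeometry.Spec.map (CommRingCat.ofHom θ)) ∧ j₉ '' T₉ = S₉ ∧ IsClosed T₉ ∧ IsIrreducible T₉ ∧ AlgebraicGeometry.IsIntegral F₉ ∧
      TCPlus.LetterDatum O (AlgebraicGeometry.Proj (MvPolynomial.homogeneousSubmodule (Fin (3 + 1)) O)) (AlgebraicGeometry.Proj.toSpecZero (MvPolynomial.homogeneousSubmodule (Fin (3 + 1)) O) ≫ AlgebraicGeometry.Spec.map (CommRingCat.ofHom (algebraMap O (MvPolynomial.homogeneousSubmodule (Fin (3 + 1)) O 0)))) (Set.range (ι ≫ AlgebraicGeometry.Proj.map φ hφ' : H ⟶ (AlgebraicGeometry.Proj (MvPolynomial.homogeneousSubmodule (Fin (3 + 1)) O)))) F₉ X₉ σ₉ j₉ (∅ : Set F₉) := by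
  classical
  letI := MvPolynomial.gradedAlgebra (σ := Fin (3 + 1)) (R := O)
  letI := MvPolynomial.gradedAlgebra (σ := Fin (3 + 1)) (R := k)
  intro φ hφ' hφ Ch hChStep hChSplit hYsp hYirr hYcl hPint hPnoeth hPreg hqprop hqsm hCh₀ Z hZ hZT hTZ hZinf S hS hSZ hSfin 𝓢 h𝓢reg h𝓢fl h𝓢tr F₂ υ hυ
    hZ₂dim hslot F₃ υ' hυ' F₉ γ' T₉ E' Es' Ns' K' htail
  -- the support of `𝓘⟨S⟩` is `S`; the blow-up `υ` is onto off `S`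
  have hsuppS : (((vanishingIdeal (⟨S, hS⟩ : Closeds (Literature.AlgebraicGeometry.Motives.projectiveSpace 3 k).left)) :
      (Literature.AlgebraicGeometry.Motives.projectiveSpace 3 k).left.IdealSheafData).support :
        Set (Literature.AlgebraicGeometry.Motives.projectiveSpace 3 k).left) = S :=
    Scheme.IdealSheafData.coe_support_vanishingIdeal _
  have hlift : ∀ y : (Literature.AlgebraicGeometry.Motives.projectiveSpace 3 k).left, y ∉ S → ∃ y₂ : F₂, υ y₂ = y := by
    intro y hy
    exact hυ.exists_preimage_of_notMem_support (by rw [← hsuppS] at hy; exact hy)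
  -- (z1) `Z₂ ⊆ T₂`
  have hZ₂T : (closure (υ ⁻¹' (Z \ S))) ⊆ (closure (υ ⁻¹' (Set.range ι \ S))) :=
    closure_mono (Set.preimage_mono (Set.sdiff_subset_sdiff_left hZT))
  -- (z2) `¬ T₂ ⊆ Z₂`: a point of `range ι ∖ Z` lifts into `T₂` and off `υ ⁻¹' Z ⊇ Z₂`
  have hZ₂sub : (closure (υ ⁻¹' (Z \ S))) ⊆ υ ⁻¹' Z := closure_minimal (fun z hz => hz.1) (hZ.preimage υ.continuous)
  have hT₂Z : ¬ ((closure (υ ⁻¹' (Set.range ι \ S))) ⊆ (closure (υ ⁻¹' (Z \ S)))) := by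
    obtain ⟨t, htT, htZ⟩ := Set.not_subset.mp hTZ
    obtain ⟨t₂, ht₂⟩ := hlift t (fun h => htZ (hSZ h))
    intro hsub
    have h1 : t₂ ∈ (closure (υ ⁻¹' (Set.range ι \ S))) := subset_closure (by rw [Set.mem_preimage, ht₂]; exact ⟨htT, fun h => htZ (hSZ h)⟩)
    have h2 := hZ₂sub (hsub h1)
    rw [Set.mem_preimage, ht₂] at h2
    exact htZ h2
  -- (z3) `Z₂` is infinite: `υ '' υ ⁻¹' (Z ∖ S) = Z ∖ S` is infinite (`S` finite)
  have hZ₂inf : (closure (υ ⁻¹' (Z \ S))).Infinite := by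
    intro hfin
    apply (hZinf.sdiff hSfin)
    refine ((hfin.subset subset_closure).image υ).subset ?_
    intro y hy
    obtain ⟨y₂, hy₂⟩ := hlift y hy.2
    exact ⟨y₂, by rw [Set.mem_preimage, hy₂]; exact hy, hy₂⟩
  exact liftNose_stage_zero_of_model hF k H ι hι hH O θ hθ φ hφ' hφ Ch hChStep hChSplit hYsp hYirr hYcl hPint hPnoeth hPreg hqprop hqsm hCh₀ S hS
    (hSZ.trans hZT) (fun h => hTZ (h.trans hSZ)) 𝓢 h𝓢reg h𝓢fl h𝓢tr F₂ υ hυ (closure (υ ⁻¹' (Z \ S))) isClosed_closure hZ₂T hT₂Z hZ₂inf hZ₂dim hslot F₃ υ' hυ'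
    F₉ γ' T₉ E' Es' Ns' K' htail

end Summit.ResolutionOfSingularities.ResolutionOfSingularities.Cruxes.EquisingularLiftNat.Sections.LiftNose

end
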